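import Summits.MatrixMultiplication.OmegaCensus.STPP222SqReflect
import Summits.MatrixMultiplication.OmegaCensus.STPP222SqSymmetry

/-!
# ω-census, the pattern `(2,2,2)²`: normal form, symmetries and the assembly theorem for kernel NON-existence proofs

HONEST FRAMING (pub-omega census; verbatim): lottery ticket; floor = certified bounds/negative ranges.
Census STRUCTURE bookkeeping (question Q7, row `k = 2`), not progress on `ω`.

Given a finite abelian group `G` with a code structure (`STPP222SqReflect.lean`), this file turns
* a kernel-evaluated search certificate `searchB … reps = true` (`STPP222SqSearch.lean`), and
* two small kernel-decided COVERING facts about `G` (every nonzero element is moved into the list `R1` by a listed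
  injective endomorphism, up to sign; for `a ∈ R1` and nonzero `dB, dC`, the CANONICAL start triple — key-minimal over
  the listed maps fixing `±a`, sign changes and the swap of the roles `B ↔ C` — is a start triple of `reps` whenever it
  passes the 13 TPP clauses of triple `0`),
into the theorem «`G` admits no two simultaneous-TPP triples of 2-subsets» (`not_exists_of_cover`).

The symmetries used (`STPP222SqSymmetry.lean`, all proved from CKSU Def. 5.1): per-triple translation with global shifts
of the `B`- and `C`-rows, injective additive maps (the tree's `IsSTPP.image`), the role swap `B ↔ C`; and the normal form
`exists_nf`.  Here: candidates / canonical start triple / guards (kernel-evaluable) and the assembly theorems.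

References: H. Cohn, R. Kleinberg, B. Szegedy, C. Umans, FOCS 2005 (arXiv:math/0511460), Def. 5.1.
Record: pub-omega HOME `pub-omega-eng2/results/c4red/K2-THRESHOLD-eng2.md` §NEG (ENG2 gen 17, 2026-08-23).
-/

open Literature.Computability.AlgebraicComplexity Finset

namespace Summit.MatrixMultiplication.OmegaCensus

namespace STPP222SqNeg

/-! ## 1. Candidates, canonical triple and guards (kernel-evaluable) -/

/-- Sign change selected by a bit. -/
def sg {G : Type} [Neg G] (ε : Bool) (x : G) : G := bif ε then -x else x

/-- Two elements of a set with prescribed oriented difference `sg ε (s₁ - s₀)`. -/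
theorem exists_oriented {G : Type} [AddCommGroup G] {S : Finset G} {s₀ s₁ : G} (h₀ : s₀ ∈ S) (h₁ : s₁ ∈ S)
    (hne : s₀ ≠ s₁) (ε : Bool) : ∃ b₀ b₁ : G, b₀ ∈ S ∧ b₁ ∈ S ∧ b₀ ≠ b₁ ∧ b₁ - b₀ = sg ε (s₁ - s₀) := by
  cases ε
  · exact ⟨s₀, s₁, h₀, h₁, hne, rfl⟩
  · exact ⟨s₁, s₀, h₁, h₀, hne.symm, by simp [sg]⟩

/-- The eight sign/swap variants of a pair, as encoded start triples with first entry `ca`. -/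
def variants {G C : Type} [AddCommGroup G] (E : Enc G C) (ca : C) (y z : G) : List (C × C × C) :=
  [(ca, E.enc y, E.enc z), (ca, E.enc (-y), E.enc z), (ca, E.enc y, E.enc (-z)), (ca, E.enc (-y), E.enc (-z)),
   (ca, E.enc z, E.enc y), (ca, E.enc (-z), E.enc y), (ca, E.enc z, E.enc (-y)), (ca, E.enc (-z), E.enc (-y))]

/-- All candidate start triples for `(a, dB, dC)`: the variants of `(f dB, f dC)` over the listed maps `f` fixing `a` up
to sign, after the variants of `(dB, dC)` itself. -/
def cands {G C : Type} [AddCommGroup G] [DecidableEq G] (E : Enc G C) (fs : List (G →+ G)) (a dB dC : G) :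
    List (C × C × C) :=
  variants E (E.enc a) dB dC ++
    fs.flatMap fun f => if f a = a ∨ f a = -a then variants E (E.enc a) (f dB) (f dC) else []

/-- Lexicographic key of an encoded triple. -/
def key3 {G C : Type} [AddCommGroup G] (E : Enc G C) (t : C × C × C) : ℕ × ℕ × ℕ :=
  (E.key t.1, E.key t.2.1, E.key t.2.2)

/-- Strict lexicographic comparison of keys (Boolean). -/
def ltKey3 (x y : ℕ × ℕ × ℕ) : Bool :=
  Nat.blt x.1 y.1 || (x.1 == y.1 && (Nat.blt x.2.1 y.2.1 || (x.2.1 == y.2.1 && Nat.blt x.2.2 y.2.2)))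

/-- The key-minimal element of `d :: l` (first one among ties). -/
def minKey3 {G C : Type} [AddCommGroup G] (E : Enc G C) (d : C × C × C) (l : List (C × C × C)) : C × C × C :=
  l.foldl (fun m t => bif ltKey3 (key3 E t) (key3 E m) then t else m) d

/-- `minKey3` returns the default or an element of the list. -/
theorem minKey3_mem {G C : Type} [AddCommGroup G] (E : Enc G C) (d : C × C × C) (l : List (C × C × C)) :
    minKey3 E d l ∈ d :: l := by
  induction l generalizing d with
  | nil => simp [minKey3]
  | cons t l ih =>
    have h := ih (bif ltKey3 (key3 E t) (key3 E d) then t else d)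
    simp only [minKey3, List.foldl_cons] at h ⊢
    rcases List.mem_cons.1 h with h | h
    · rw [h]; cases ltKey3 (key3 E t) (key3 E d) <;> simp
    · exact List.mem_cons_of_mem _ (List.mem_cons_of_mem _ h)

/-- The CANONICAL start triple of `(a, dB, dC)`: the key-minimal candidate. -/
def canon {G C : Type} [AddCommGroup G] [DecidableEq G] (E : Enc G C) (fs : List (G →+ G)) (a dB dC : G) :
    C × C × C :=
  minKey3 E (E.enc a, E.enc dB, E.enc dC) (cands E fs a dB dC)

/-- The canonical triple is one of the candidates. -/
theorem canon_mem_cands {G C : Type} [AddCommGroup G] [DecidableEq G] (E : Enc G C) (fs : List (G →+ G))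
    (a dB dC : G) : canon E fs a dB dC ∈ cands E fs a dB dC := by
  have h := minKey3_mem E (E.enc a, E.enc dB, E.enc dC) (cands E fs a dB dC)
  rcases List.mem_cons.1 h with h | h
  · rw [canon, h]; simp [cands, variants]
  · exact h

/-- Unpacking a candidate: a map fixing `a` up to sign (the identity or a listed one), a possible swap, two signs. -/
theorem exists_of_mem_cands {G C : Type} [AddCommGroup G] [DecidableEq G] (E : Enc G C) (fs : List (G →+ G))
    (a dB dC : G) {t : C × C × C} (ht : t ∈ cands E fs a dB dC) :
    ∃ f : G →+ G, (f = AddMonoidHom.id G ∨ f ∈ fs) ∧ (f a = a ∨ f a = -a) ∧ ∃ sw ε₂ ε₃ : Bool,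
      t = (E.enc a, E.enc (sg ε₂ (f (bif sw then dC else dB))), E.enc (sg ε₃ (f (bif sw then dB else dC)))) := by
  have hv : ∀ (f : G →+ G) (y z : G), t ∈ variants E (E.enc a) (f y) (f z) → ∃ sw ε₂ ε₃ : Bool,
      t = (E.enc a, E.enc (sg ε₂ (f (bif sw then z else y))), E.enc (sg ε₃ (f (bif sw then y else z)))) := by
    intro f y z h
    simp only [variants, List.mem_cons, List.mem_nil_iff, or_false] at h
    rcases h with rfl | rfl | rfl | rfl | rfl | rfl | rfl | rfl
    · exact ⟨false, false, false, rfl⟩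
    · exact ⟨false, true, false, rfl⟩
    · exact ⟨false, false, true, rfl⟩
    · exact ⟨false, true, true, rfl⟩
    · exact ⟨true, false, false, rfl⟩
    · exact ⟨true, true, false, rfl⟩
    · exact ⟨true, false, true, rfl⟩
    · exact ⟨true, true, true, rfl⟩
  simp only [cands, List.mem_append, List.mem_flatMap] at ht
  rcases ht with ht | ⟨f, hf, ht⟩
  · exact ⟨AddMonoidHom.id G, .inl rfl, .inl rfl, hv (AddMonoidHom.id G) dB dC ht⟩
  · by_cases hfa : f a = a ∨ f a = -a
    · rw [if_pos hfa] at ht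
      exact ⟨f, .inr hf, hfa, hv f dB dC ht⟩
    · rw [if_neg hfa] at ht; simp at ht

/-- The depth-0 guard on an encoded triple: the 13 TPP clauses of triple `0`. -/
def tpp0 {C : Type} [DecidableEq C] (o : COps C) (t : C × C × C) : Bool :=
  levelB o ⟨t.1, t.2.1, t.2.2, none, none, none, none, none⟩ L0

/-- The `q`-coverage check of a start list: each start either carries the full code list, or its triple's `q`-lists
jointly cover it. -/
def qcovB {C : Type} [DecidableEq C] (el : List C) (reps : List (C × C × C × List C)) : Bool :=
  reps.all fun e => (e.2.2.2 == el) ||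
    el.all fun cq => reps.any fun e' => (e'.1 == e.1) && (e'.2.1 == e.2.1) && (e'.2.2.1 == e.2.2.1) && e'.2.2.2.elem cq

/-- Unpacking the `q`-coverage check. -/
theorem exists_qs_of_qcovB {C : Type} [DecidableEq C] {el : List C} {reps : List (C × C × C × List C)}
    (h : qcovB el reps = true) {ca cb cc : C} {qs : List C} (ht : (ca, cb, cc, qs) ∈ reps) {cq : C}
    (hcq : cq ∈ el) : ∃ qs', (ca, cb, cc, qs') ∈ reps ∧ cq ∈ qs' := by
  unfold qcovB at h
  have h1 := List.all_eq_true.1 h _ ht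
  simp only [Bool.or_eq_true, beq_iff_eq, List.all_eq_true, List.any_eq_true, Bool.and_eq_true] at h1
  rcases h1 with h1 | h1
  · exact ⟨qs, ht, h1 ▸ hcq⟩
  · obtain ⟨⟨ca', cb', cc', qs'⟩, he', ⟨⟨h₁, h₂⟩, h₃⟩, h₄⟩ := h1 cq hcq
    simp only at h₁ h₂ h₃ h₄
    subst h₁; subst h₂; subst h₃
    exact ⟨qs', he', by simpa using h₄⟩

/-- A start-list entry from an encoded triple and a `q`-list. -/
def withQs {C : Type} (t : C × C × C) (qs : List C) : C × C × C × List C := (t.1, t.2.1, t.2.2, qs)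

/-- Whether an encoded triple is the triple of some entry of the start list (Boolean, for `decide`). -/
def memTriple {C : Type} [DecidableEq C] (t : C × C × C) (reps : List (C × C × C × List C)) : Bool :=
  reps.any fun e => (e.1 == t.1) && (e.2.1 == t.2.1) && (e.2.2.1 == t.2.2)

/-- Unpacking `memTriple`. -/
theorem exists_qs_of_memTriple {C : Type} [DecidableEq C] {t : C × C × C} {reps : List (C × C × C × List C)}
    (h : memTriple t reps = true) : ∃ qs, withQs t qs ∈ reps := by
  simp only [memTriple, List.any_eq_true, Bool.and_eq_true, beq_iff_eq] at h
  obtain ⟨⟨ca, cb, cc, qs⟩, he, ⟨h₁, h₂⟩, h₃⟩ := h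
  simp only at h₁ h₂ h₃
  refine ⟨qs, ?_⟩
  rw [withQs, ← h₁, ← h₂, ← h₃]; exact he

/-! ## 2. The assembly theorem -/

/-- From a normal-form configuration (membership form) to the depth-0 guard on its encoded difference triple. -/
theorem tpp0_of_nf {G C : Type} [AddCommGroup G] [DecidableEq G] [DecidableEq C] (E : Enc G C)
    {SA SB SC : Fin 2 → Finset G} {a b c q q' r r' a' : G} (ha : a ≠ 0) (ha' : a' ≠ 0) (hb : b ≠ 0) (hq : q ≠ q')
    (hc : c ≠ 0) (hr : r ≠ r') (hA0 : (0 : G) ∈ SA 0) (haA : a ∈ SA 0) (hA1 : (0 : G) ∈ SA 1) (haA' : a' ∈ SA 1)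
    (hB0 : (0 : G) ∈ SB 0) (hbB : b ∈ SB 0) (hqB : q ∈ SB 1) (hqB' : q' ∈ SB 1) (hC0 : (0 : G) ∈ SC 0)
    (hcC : c ∈ SC 0) (hrC : r ∈ SC 1) (hrC' : r' ∈ SC 1) (hS : IsSTPP SA SB SC) :
    tpp0 E.ops (E.enc a, E.enc b, E.enc c) = true :=
  levelB_maskWith E.ops (fullCfg E a b c q q' r r' a') false false false false false L0
    (clauseB_fullCfg E ha ha' hb hq hc hr hA0 haA hA1 haA' hB0 hbB hqB hqB' hC0 hcC hrC hrC' hS)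


/-- CORE CONTRADICTION.  An STPP configuration with two named elements in each of its six sets, whose oriented difference
triple `(u₁ - u₀, v₁ - v₀, c₁ - c₀)` is — when it passes the depth-0 guard — a start triple of a start list that passed
the kernel search and the `q`-coverage check, cannot exist. [cite: CohnKleinbergSzegedyUmans2005, Def. 5.1] -/
theorem nf_contra {G C : Type} [AddCommGroup G] [DecidableEq G] [DecidableEq C] (E : Enc G C)
    {el : List C} (hel : ∀ x : G, E.enc x ∈ el) {reps : List (C × C × C × List C)}
    (hs : searchB E.ops el E.key reps = true) (hq : qcovB el reps = true)
    {SA SB SC : Fin 2 → Finset G} (hS : IsSTPP SA SB SC) {u₀ u₁ y₀ y₁ v₀ v₁ w₀ w₁ c₀ c₁ e₀ e₁ : G}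
    (hu₀ : u₀ ∈ SA 0) (hu₁ : u₁ ∈ SA 0) (hu : u₀ ≠ u₁) (hy₀ : y₀ ∈ SA 1) (hy₁ : y₁ ∈ SA 1) (hy : y₀ ≠ y₁)
    (hv₀ : v₀ ∈ SB 0) (hv₁ : v₁ ∈ SB 0) (hv : v₀ ≠ v₁) (hw₀ : w₀ ∈ SB 1) (hw₁ : w₁ ∈ SB 1) (hw : w₀ ≠ w₁)
    (hc₀ : c₀ ∈ SC 0) (hc₁ : c₁ ∈ SC 0) (hc : c₀ ≠ c₁) (he₀ : e₀ ∈ SC 1) (he₁ : e₁ ∈ SC 1) (he : e₀ ≠ e₁)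
    (hrep : tpp0 E.ops (E.enc (u₁ - u₀), E.enc (v₁ - v₀), E.enc (c₁ - c₀)) = true →
      ∃ qs, withQs (E.enc (u₁ - u₀), E.enc (v₁ - v₀), E.enc (c₁ - c₀)) qs ∈ reps) : False := by
  obtain ⟨A', B', C', q, q', r, r', hS', hA0, haA, hA1, haA', hB0, hbB, hqB, hqB', hqq, hC0, hcC, hrC, hrC', hrr⟩ :=
    exists_nf hS hu₀ hu₁ hy₀ hy₁ hv₀ hv₁ hw₀ hw₁ hw hc₀ hc₁ he₀ he₁ he
  have ha : u₁ - u₀ ≠ 0 := sub_ne_zero.2 (Ne.symm hu)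
  have ha' : y₁ - y₀ ≠ 0 := sub_ne_zero.2 (Ne.symm hy)
  have hb : v₁ - v₀ ≠ 0 := sub_ne_zero.2 (Ne.symm hv)
  have hcc : c₁ - c₀ ≠ 0 := sub_ne_zero.2 (Ne.symm hc)
  have hg := tpp0_of_nf E ha ha' hb hqq hcc hrr hA0 haA hA1 haA' hB0 hbB hqB hqB' hC0 hcC hrC hrC' hS'
  obtain ⟨qs, hqs⟩ := hrep hg
  simp only [withQs] at hqs
  -- order the two elements of `B' 1` and of `C' 1` by key
  have hkq : E.key (E.enc q) ≠ E.key (E.enc q') := fun h => hqq (E.key_inj h)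
  have hkr : E.key (E.enc r) ≠ E.key (E.enc r') := fun h => hrr (E.key_inj h)
  rcases Nat.lt_or_gt_of_ne hkq with hlq | hlq <;> rcases Nat.lt_or_gt_of_ne hkr with hlr | hlr
  · obtain ⟨qs', hrep', hq'⟩ := exists_qs_of_qcovB hq hqs (hel q)
    exact nf_false_of_searchB E hel hs ha ha' hb hcc hlq hlr hA0 haA hA1 haA' hB0 hbB hqB hqB' hC0 hcC hrC hrC'
      hrep' hq' hS'
  · obtain ⟨qs', hrep', hq'⟩ := exists_qs_of_qcovB hq hqs (hel q)
    exact nf_false_of_searchB E hel hs ha ha' hb hcc hlq hlr hA0 haA hA1 haA' hB0 hbB hqB hqB' hC0 hcC hrC' hrC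
      hrep' hq' hS'
  · obtain ⟨qs', hrep', hq'⟩ := exists_qs_of_qcovB hq hqs (hel q')
    exact nf_false_of_searchB E hel hs ha ha' hb hcc hlq hlr hA0 haA hA1 haA' hB0 hbB hqB' hqB hC0 hcC hrC hrC'
      hrep' hq' hS'
  · obtain ⟨qs', hrep', hq'⟩ := exists_qs_of_qcovB hq hqs (hel q')
    exact nf_false_of_searchB E hel hs ha ha' hb hcc hlq hlr hA0 haA hA1 haA' hB0 hbB hqB' hqB hC0 hcC hrC' hrC
      hrep' hq' hS'

/-- Step of the assembly: from a configuration whose `A 0`-difference is `a ∈ R1` (as `u₁ - u₀`) and the covering fact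
for `a`, a contradiction. [cite: CohnKleinbergSzegedyUmans2005, Def. 5.1] -/
theorem contra_of_R1 {G C : Type} [AddCommGroup G] [DecidableEq G] [DecidableEq C] (E : Enc G C)
    {el : List C} (hel : ∀ x : G, E.enc x ∈ el) {reps : List (C × C × C × List C)}
    (hs : searchB E.ops el E.key reps = true) (hq : qcovB el reps = true)
    (fs : List (G →+ G)) (hinj : ∀ f ∈ fs, Function.Injective f) {a : G}
    (hC2 : ∀ dB dC : G, dB ≠ 0 → dC ≠ 0 → tpp0 E.ops (canon E fs a dB dC) = true →
      memTriple (canon E fs a dB dC) reps = true)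
    {SA SB SC : Fin 2 → Finset G} (hS : IsSTPP SA SB SC) {u₀ u₁ y₀ y₁ v₀ v₁ w₀ w₁ c₀ c₁ e₀ e₁ : G}
    (hu₀ : u₀ ∈ SA 0) (hu₁ : u₁ ∈ SA 0) (hu : u₀ ≠ u₁) (hua : u₁ - u₀ = a) (hy₀ : y₀ ∈ SA 1) (hy₁ : y₁ ∈ SA 1)
    (hy : y₀ ≠ y₁) (hv₀ : v₀ ∈ SB 0) (hv₁ : v₁ ∈ SB 0) (hv : v₀ ≠ v₁) (hw₀ : w₀ ∈ SB 1) (hw₁ : w₁ ∈ SB 1)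
    (hw : w₀ ≠ w₁) (hc₀ : c₀ ∈ SC 0) (hc₁ : c₁ ∈ SC 0) (hc : c₀ ≠ c₁) (he₀ : e₀ ∈ SC 1) (he₁ : e₁ ∈ SC 1)
    (he : e₀ ≠ e₁) : False := by
  set dB := v₁ - v₀ with hdB
  set dC := c₁ - c₀ with hdC
  have hdB0 : dB ≠ 0 := sub_ne_zero.2 (Ne.symm hv)
  have hdC0 : dC ≠ 0 := sub_ne_zero.2 (Ne.symm hc)
  obtain ⟨g, hg, hga, sw, ε₂, ε₃, ht⟩ := exists_of_mem_cands E fs a dB dC (canon_mem_cands E fs a dB dC)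
  have hgi : Function.Injective g := by
    rcases hg with rfl | hg
    · exact fun x y h => h
    · exact hinj g hg
  -- orientation of `A 0` after `g`
  have horA : ∃ b₀ b₁ : G, b₀ ∈ (SA 0).image g ∧ b₁ ∈ (SA 0).image g ∧ b₀ ≠ b₁ ∧ b₁ - b₀ = a := by
    rcases hga with h | h
    · exact ⟨g u₀, g u₁, mem_image_of_mem g hu₀, mem_image_of_mem g hu₁, fun e => hu (hgi e),
        by rw [← map_sub, hua, h]⟩
    · exact ⟨g u₁, g u₀, mem_image_of_mem g hu₁, mem_image_of_mem g hu₀, fun e => hu (hgi e).symm,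
        by rw [← map_sub, ← neg_sub, hua, map_neg, h, neg_neg]⟩
  obtain ⟨b₀, b₁, hb₀, hb₁, hb, hba⟩ := horA
  have hgy : g y₀ ≠ g y₁ := fun e => hy (hgi e)
  have hgw : g w₀ ≠ g w₁ := fun e => hw (hgi e)
  have hge : g e₀ ≠ g e₁ := fun e => he (hgi e)
  cases sw
  · -- no swap: roles (A, B, C)
    have hS₂ : IsSTPP (fun t => (SA t).image g) (fun t => (SB t).image g) (fun t => (SC t).image g) := hS.image g hgi
    obtain ⟨p₀, p₁, hp₀, hp₁, hp, hpd⟩ :=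
      exists_oriented (mem_image_of_mem g hv₀) (mem_image_of_mem g hv₁) (fun e => hv (hgi e)) ε₂
    obtain ⟨s₀, s₁, hs₀, hs₁, hss, hsd⟩ :=
      exists_oriented (mem_image_of_mem g hc₀) (mem_image_of_mem g hc₁) (fun e => hc (hgi e)) ε₃
    refine nf_contra E hel hs hq hS₂ hb₀ hb₁ hb (mem_image_of_mem g hy₀) (mem_image_of_mem g hy₁) hgy hp₀ hp₁ hp
      (mem_image_of_mem g hw₀) (mem_image_of_mem g hw₁) hgw hs₀ hs₁ hss (mem_image_of_mem g he₀)
      (mem_image_of_mem g he₁) hge ?_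
    rw [hba, hpd, hsd, ← map_sub, ← map_sub, ← hdB, ← hdC]
    simp only [cond_false] at ht
    rw [← ht]
    exact fun h => exists_qs_of_memTriple (hC2 dB dC hdB0 hdC0 h)
  · -- swap: roles (A, C, B)
    have hS₂ : IsSTPP (fun t => (SA t).image g) (fun t => (SC t).image g) (fun t => (SB t).image g) :=
      (isSTPP_swapBC hS).image g hgi
    obtain ⟨p₀, p₁, hp₀, hp₁, hp, hpd⟩ :=
      exists_oriented (mem_image_of_mem g hc₀) (mem_image_of_mem g hc₁) (fun e => hc (hgi e)) ε₂
    obtain ⟨s₀, s₁, hs₀, hs₁, hss, hsd⟩ :=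
      exists_oriented (mem_image_of_mem g hv₀) (mem_image_of_mem g hv₁) (fun e => hv (hgi e)) ε₃
    refine nf_contra E hel hs hq hS₂ hb₀ hb₁ hb (mem_image_of_mem g hy₀) (mem_image_of_mem g hy₁) hgy hp₀ hp₁ hp
      (mem_image_of_mem g he₀) (mem_image_of_mem g he₁) hge hs₀ hs₁ hss (mem_image_of_mem g hw₀)
      (mem_image_of_mem g hw₁) hgw ?_
    rw [hba, hpd, hsd, ← map_sub, ← map_sub, ← hdB, ← hdC]
    simp only [cond_true] at ht
    rw [← ht]
    exact fun h => exists_qs_of_memTriple (hC2 dB dC hdB0 hdC0 h)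

/-- ASSEMBLY THEOREM.  Data: a code structure `E`, the code list `el` of all elements, a start list `reps` whose kernel
search succeeded and which passes the `q`-coverage check, the element list `elG`, first-coordinate representatives
`R1` with injective maps `auts1`, and injective maps `stab a`; the two COVERING facts `hC1`, `hC2` (kernel-decided per
group).  Conclusion: `G` admits no two simultaneous-TPP triples of 2-subsets. [cite: CohnKleinbergSzegedyUmans2005, Def. 5.1] -/
theorem not_exists_of_cover {G C : Type} [AddCommGroup G] [DecidableEq G] [DecidableEq C] (E : Enc G C)
    (el : List C) (hel : ∀ x : G, E.enc x ∈ el) (reps : List (C × C × C × List C))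
    (hs : searchB E.ops el E.key reps = true) (hq : qcovB el reps = true)
    (elG : List G) (helG : ∀ x : G, x ∈ elG) (R1 : List G) (auts1 : List (G →+ G))
    (hinj1 : ∀ f ∈ auts1, Function.Injective f)
    (hC1 : ∀ d ∈ elG, d ≠ 0 → ∃ f ∈ auts1, f d ∈ R1 ∨ -f d ∈ R1)
    (stab : G → List (G →+ G)) (hinjS : ∀ a ∈ R1, ∀ f ∈ stab a, Function.Injective f)
    (hC2 : ∀ a ∈ R1, ∀ dB ∈ elG, ∀ dC ∈ elG, dB ≠ 0 → dC ≠ 0 → tpp0 E.ops (canon E (stab a) a dB dC) = true →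
      memTriple (canon E (stab a) a dB dC) reps = true) :
    ¬ ∃ A B C : Fin 2 → Finset G, IsSTPP A B C ∧ ∀ i, (A i).card = 2 ∧ (B i).card = 2 ∧ (C i).card = 2 := by
  rintro ⟨A, B, C, hS, hcard⟩
  obtain ⟨x₀, x₁, hx, hA0⟩ := Finset.card_eq_two.1 (hcard 0).1
  obtain ⟨y₀, y₁, hy, hA1⟩ := Finset.card_eq_two.1 (hcard 1).1
  obtain ⟨m₀, m₁, hm, hB0⟩ := Finset.card_eq_two.1 (hcard 0).2.1
  obtain ⟨n₀, n₁, hn, hB1⟩ := Finset.card_eq_two.1 (hcard 1).2.1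
  obtain ⟨o₀, o₁, ho, hC0⟩ := Finset.card_eq_two.1 (hcard 0).2.2
  obtain ⟨p₀, p₁, hp, hC1'⟩ := Finset.card_eq_two.1 (hcard 1).2.2
  have mx₀ : x₀ ∈ A 0 := by rw [hA0]; simp
  have mx₁ : x₁ ∈ A 0 := by rw [hA0]; simp
  have my₀ : y₀ ∈ A 1 := by rw [hA1]; simp
  have my₁ : y₁ ∈ A 1 := by rw [hA1]; simp
  have mm₀ : m₀ ∈ B 0 := by rw [hB0]; simp
  have mm₁ : m₁ ∈ B 0 := by rw [hB0]; simp
  have mn₀ : n₀ ∈ B 1 := by rw [hB1]; simp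
  have mn₁ : n₁ ∈ B 1 := by rw [hB1]; simp
  have mo₀ : o₀ ∈ C 0 := by rw [hC0]; simp
  have mo₁ : o₁ ∈ C 0 := by rw [hC0]; simp
  have mp₀ : p₀ ∈ C 1 := by rw [hC1']; simp
  have mp₁ : p₁ ∈ C 1 := by rw [hC1']; simp
  have hd : x₁ - x₀ ≠ 0 := sub_ne_zero.2 (Ne.symm hx)
  obtain ⟨f, hf, hfR⟩ := hC1 (x₁ - x₀) (helG _) hd
  have hfi := hinj1 f hf
  have hS₁ : IsSTPP (fun t => (A t).image f) (fun t => (B t).image f) (fun t => (C t).image f) := hS.image f hfi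
  -- orientation of `A 0` under `f`
  obtain ⟨u₀, u₁, hu₀, hu₁, hu, a, haR, hua⟩ :
      ∃ u₀ u₁ : G, u₀ ∈ (A 0).image f ∧ u₁ ∈ (A 0).image f ∧ u₀ ≠ u₁ ∧ ∃ a ∈ R1, u₁ - u₀ = a := by
    rcases hfR with h | h
    · exact ⟨f x₀, f x₁, mem_image_of_mem f mx₀, mem_image_of_mem f mx₁, fun e => hx (hfi e), _, h,
        by rw [map_sub]⟩
    · exact ⟨f x₁, f x₀, mem_image_of_mem f mx₁, mem_image_of_mem f mx₀, fun e => hx (hfi e).symm, _, h,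
        by rw [map_sub, neg_sub]⟩
  exact contra_of_R1 E hel hs hq (stab a) (hinjS a haR)
    (fun dB dC hB hC hg => hC2 a haR dB (helG _) dC (helG _) hB hC hg) hS₁ hu₀ hu₁ hu hua
    (mem_image_of_mem f my₀) (mem_image_of_mem f my₁) (fun e => hy (hfi e)) (mem_image_of_mem f mm₀)
    (mem_image_of_mem f mm₁) (fun e => hm (hfi e)) (mem_image_of_mem f mn₀) (mem_image_of_mem f mn₁)
    (fun e => hn (hfi e)) (mem_image_of_mem f mo₀) (mem_image_of_mem f mo₁) (fun e => ho (hfi e))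
    (mem_image_of_mem f mp₀) (mem_image_of_mem f mp₁) (fun e => hp (hfi e))

end STPP222SqNeg

end Summit.MatrixMultiplication.OmegaCensus
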